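import Summits.CriticalPhenomena.SAWScalingLimit.Theses.SAWMassiveIsingTilt
import Summits.CriticalPhenomena.SAWScalingLimit.Theorems.SAWMassiveIsingTiltDefs
import Literature.Probability.LatticeModels.GKSInequalities
import Literature.Probability.LatticeModels.GriffithsMonotonicity
import Literature.Probability.LatticeModels.TwoPointPlusDecay
import Literature.Probability.LatticeModels.MeanFieldBoundGHS
import Literature.Probability.LatticeModels.ModifiedSimonInequality
import Literature.Probability.LatticeModels.TriangularLatticeProofs
import HarnessLib

/-!
# Crux `MassiveWindowSLE` (stmt-CriticalPhenomena-7685), line `registered` (skeleton r7):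
stub `stub_isingTwoPointLocality` — locality of the high-temperature two-point function

Route `SAWMassiveIsingTilt` of `CriticalPhenomena/SAWScalingLimit`; stub `MIsing` of the skeleton r7
of the line `registered` of the crux `MassiveWindowSLE`.

What. For two finite subgraphs `H₁, H₂ ≤ hexGraph` of the honeycomb lattice, read inside vertex sets
`S₁, S₂`, which AGREE inside a finite set `B ∋ u, v` (`B ⊆ S₁ ∩ S₂`, same adjacency on `B × B`), the
loop-gas (high-temperature Ising) two-point functions `W(H_j, S_j, u, v; t) / Zloop H_j S_j t`
(`t = tanh β`; `W` = sum over edge sets with odd-degree vertices exactly `{u, v}`, `Zloop` = sum over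
even edge sets) differ by at most `9 β² · #B · Σ_{x ∈ Bd} (W_B(u, x) + W_B(v, x)) / Zloop_B`
(boundary two-point functions of the free loop model of `hexGraph` in the volume `B`; `Bd ⊇` the
vertices of `B` with a honeycomb neighbour outside `B`, `u, v ∉ Bd`).

How (all inequalities are tree theorems of `Literature/Probability/LatticeModels`).
* Bridge (`itl_finsum_eq_hteSum`, `itl_sandwich`): by the high-temperature expansion
  (`isingCorr_free_eq_hteSum_div`, Duminil-Copin 2016 §2.2.1) `W / Zloop = ⟨σ_uσ_v⟩^free_{Λ; H}` for
  the finite volume `Λ = B ∪ {endpoints of edges of H inside S} ⊆ S` (the free model of `H` in `Λ`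
  sees exactly the edges of `H` inside `S`).
* Sandwich (`itl_sandwich`): `⟨σ_uσ_v⟩^free_{B; H} ≤ ⟨σ_uσ_v⟩^free_{Λ; H}` (free correlations are
  monotone in the volume, `isingCorr_free_le_of_subset`, GKS II) and
  `⟨σ_uσ_v⟩^free_{Λ; H} ≤ ⟨σ_uσ_v⟩^+_{Λ; H} ≤ ⟨σ_uσ_v⟩^+_{B; H}` (`isingCorr_le_isingCorr_plus`,
  `isingCorr_plus_le_of_subset`). The free state in volume `B` only sees the edges inside `B`
  (`isingMeasure_free_congr_edgesIn`), which agree for `j = 1, 2`.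
* Boundary bound (`geo_plus_sub_free_le`): `⟨σ_uσ_v⟩^+_B - ⟨σ_uσ_v⟩^free_B ≤ β · #(boundary bonds) ·
  (⟨σ_u⟩^+_B + ⟨σ_v⟩^+_B)` (GHS, `isingTwoPoint_plus_sub_free_le_boundary`), `#(boundary bonds) ≤ 3 #B`
  (honeycomb degree `3`, `card_neighborSet_hexGraph_holds`), and
  `⟨σ_u⟩^+_B ≤ β Σ_x Σ_{w ∼ x, w ∉ B} ⟨σ_uσ_x⟩^free_{B; G}` (`isingCorr_plus_singleton_le_boundary_twoPoint`),
  whose terms live on `x ∈ Bd`, have multiplicity `≤ 3`, and are bounded by the `hexGraph` two-point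
  function (graph monotonicity `isingCorr_free_mono_graph`, GKS II) `= W_B(u, x) / Zloop_B` (bridge).

References: H. Duminil-Copin, random currents lecture notes (2016), §2.2.1 (HT expansion);
S. Friedli, Y. Velenik, *Statistical Mechanics of Lattice Systems* (CUP 2017), Thm. 3.20, Exercises
3.12, 3.31, §3.8.1; R. B. Griffiths, C. A. Hurst, S. Sherman, J. Math. Phys. 11 (1970) 790 (GHS).
-/

noncomputable section

open scoped BigOperators Topology Classical MeasureTheory NNReal ENNReal
open Filter Set MeasureTheory
open Literature.Probability Literature.Probability.LatticeModels Literature.Probability.RandomPlanarGeometry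

namespace Summit.CriticalPhenomena.SAWScalingLimit.Theorems.MassiveWindowSLE.Birth

open scoped symmDiff
open Summit.CriticalPhenomena.SAWScalingLimit.Theorems.SAWMassiveIsingTilt (Zloop)

/-! ### Subgraphs of the honeycomb lattice are locally finite of degree at most three -/

/-- A subgraph of the honeycomb lattice admits a `LocallyFinite` structure: every face of
`hexGraph` has three neighbours (`card_neighborSet_hexGraph_holds`). -/
theorem geo_nonempty_locallyFinite {G : SimpleGraph HexVertex} (hG : G ≤ hexGraph) :
    Nonempty G.LocallyFinite :=
  ⟨fun v => ((Set.finite_of_ncard_ne_zero (by rw [card_neighborSet_hexGraph_holds v]; norm_num) :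
    (hexGraph.neighborSet v).Finite).subset fun _ hw => hG hw).fintype⟩

/-- A subgraph of the honeycomb lattice has degree at most `3` at every vertex (for any
`LocallyFinite` structure). -/
theorem geo_card_neighborFinset_le_three {G : SimpleGraph HexVertex} [G.LocallyFinite]
    (hG : G ≤ hexGraph) (x : HexVertex) : (G.neighborFinset x).card ≤ 3 := by
  have h1 : (G.neighborSet x).ncard ≤ (hexGraph.neighborSet x).ncard :=
    Set.ncard_le_ncard (fun _ hw => hG hw)
      (Set.finite_of_ncard_ne_zero (by rw [card_neighborSet_hexGraph_holds x]; norm_num))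
  rwa [card_neighborSet_hexGraph_holds x, Set.ncard_eq_toFinset_card'] at h1

/-! ### The high-temperature bridge: loop sums are `hteSum` -/

/-- **Bridge.** The `finsum` over edge sets of `G` inside `Λ` whose odd-degree vertices are exactly
the elements of `A`, of `t ^ |E|`, is the high-temperature generating sum `hteSum G Λ t A`. -/
theorem itl_finsum_eq_hteSum {V : Type*} [DecidableEq V] (G : SimpleGraph V) [G.LocallyFinite]
    (Λ : Finset V) (t : ℝ) (A : Finset V) :
    ∑ᶠ E ∈ {E : Finset (Sym2 V) | (∀ e ∈ E, e ∈ G.edgeSet ∧ ∀ w ∈ e, w ∈ (↑Λ : Set V)) ∧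
        ∀ w : V, (Odd (E.filter (fun e => w ∈ e)).card ↔ w ∈ A)}, t ^ E.card =
      hteSum G Λ t A := by
  have key : ∀ {E : Finset (Sym2 V)} {w : V}, Odd (E.filter (fun e => w ∈ e)).card →
      ∃ e ∈ E, w ∈ e := fun {E w} hodd => by
    obtain ⟨e, he⟩ := Finset.card_pos.1 (Nat.pos_of_ne_zero fun h0 => Nat.not_odd_zero (h0 ▸ hodd))
    exact ⟨e, (Finset.mem_filter.1 he).1, (Finset.mem_filter.1 he).2⟩
  have hset : {E : Finset (Sym2 V) | (∀ e ∈ E, e ∈ G.edgeSet ∧ ∀ w ∈ e, w ∈ (↑Λ : Set V)) ∧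
        ∀ w : V, (Odd (E.filter (fun e => w ∈ e)).card ↔ w ∈ A)} =
      ↑((edgesIn G Λ).powerset.filter (fun F => oddVerts Λ F = A)) := by
    ext E
    simp only [Set.mem_setOf_eq, Finset.coe_filter, Finset.mem_powerset]
    constructor
    · rintro ⟨h1, h2⟩
      refine ⟨fun e he => mem_edgesIn_iff.2 (h1 e he), ?_⟩
      ext w
      simp only [oddVerts, Finset.mem_filter]
      refine ⟨fun h => (h2 w).1 h.2, fun hw => ?_⟩
      obtain ⟨e, he, hwe⟩ := key ((h2 w).2 hw)
      exact ⟨(h1 e he).2 w hwe, (h2 w).2 hw⟩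
    · rintro ⟨h1, h2⟩
      refine ⟨fun e he => mem_edgesIn_iff.1 (h1 he), fun w => ?_⟩
      rw [← h2]
      simp only [oddVerts, Finset.mem_filter]
      refine ⟨fun hodd => ?_, fun h => h.2⟩
      obtain ⟨e, he, hwe⟩ := key hodd
      exact ⟨(mem_edgesIn_iff.1 (h1 he)).2 w hwe, hodd⟩
  rw [hset, finsum_mem_coe_finset, hteSum]

/-- Bridge, pair form: odd vertices "`w = a ∨ w = b`" give `hteSum G Λ t {a, b}`. -/
theorem itl_finsum_pair_eq_hteSum {V : Type*} [DecidableEq V] (G : SimpleGraph V) [G.LocallyFinite]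
    (Λ : Finset V) (t : ℝ) (a b : V) :
    ∑ᶠ E ∈ {E : Finset (Sym2 V) | (∀ e ∈ E, e ∈ G.edgeSet ∧ ∀ w ∈ e, w ∈ (↑Λ : Set V)) ∧
        ∀ w : V, (Odd (E.filter (fun e => w ∈ e)).card ↔ (w = a ∨ w = b))}, t ^ E.card =
      hteSum G Λ t {a, b} := by
  rw [← itl_finsum_eq_hteSum G Λ t {a, b}]
  simp only [Finset.mem_insert, Finset.mem_singleton]

/-- Bridge, even form: all degrees even gives the loop partition sum `hteSum G Λ t ∅`. -/
theorem itl_finsum_even_eq_hteSum {V : Type*} [DecidableEq V] (G : SimpleGraph V) [G.LocallyFinite]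
    (Λ : Finset V) (t : ℝ) :
    ∑ᶠ E ∈ {E : Finset (Sym2 V) | (∀ e ∈ E, e ∈ G.edgeSet ∧ ∀ w ∈ e, w ∈ (↑Λ : Set V)) ∧
        ∀ w : V, Even (E.filter (fun e => w ∈ e)).card}, t ^ E.card =
      hteSum G Λ t ∅ := by
  rw [← itl_finsum_eq_hteSum G Λ t ∅]
  simp only [Finset.notMem_empty, iff_false, Nat.not_odd_iff_even]

/-- `{a} ∆ {b} = {a, b}` for `a ≠ b`. -/
theorem itl_symmDiff_singleton_eq_pair {V : Type*} [DecidableEq V] {a b : V} (hab : a ≠ b) :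
    ({a} : Finset V) ∆ {b} = {a, b} := by
  rw [pair_eq_symmDiff hab, symmDiff_comm]

/-! ### The GKS sandwich of the loop two-point function -/

/-- **Sandwich.** For a locally finite `H` with finitely many edges, a vertex set `S`, a finite
`B ⊆ S` and `u, v ∈ B`: the loop two-point function `W(H, S, u, v; tanh β) / Zloop H S (tanh β)`
equals `⟨σ_uσ_v⟩^free_{Λ; H}` for the volume `Λ = B ∪ {endpoints of edges of H inside S} ⊆ S`
(high-temperature expansion: the free model in `Λ` sees exactly the edges of `H` inside `S`), hence
lies between `⟨σ_{{u,v}}⟩^free_{B; H}` (volume monotonicity of free correlations, GKS II) and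
`⟨σ_{{u,v}}⟩^+_{B; H}` (`free ≤ +`, antitonicity of `+` correlations in the volume). -/
theorem itl_sandwich {H : SimpleGraph HexVertex} [H.LocallyFinite] (hfin : H.edgeSet.Finite)
    {S : Set HexVertex} {B : Finset HexVertex} (hBS : (↑B : Set HexVertex) ⊆ S) {u v : HexVertex}
    (hu : u ∈ B) (hv : v ∈ B) {β : ℝ} (hβ : 0 ≤ β) :
    isingCorr H B β 0 .free {u, v} ≤
        (∑ᶠ E ∈ {E : Finset (Sym2 HexVertex) | (∀ e ∈ E, e ∈ H.edgeSet ∧ ∀ w ∈ e, w ∈ S) ∧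
            ∀ w : HexVertex, (Odd (E.filter (fun e => w ∈ e)).card ↔ (w = u ∨ w = v))},
          Real.tanh β ^ E.card) / Zloop H S (Real.tanh β) ∧
      (∑ᶠ E ∈ {E : Finset (Sym2 HexVertex) | (∀ e ∈ E, e ∈ H.edgeSet ∧ ∀ w ∈ e, w ∈ S) ∧
            ∀ w : HexVertex, (Odd (E.filter (fun e => w ∈ e)).card ↔ (w = u ∨ w = v))},
          Real.tanh β ^ E.card) / Zloop H S (Real.tanh β) ≤
        isingCorr H B β 0 .plus {u, v} := by
  -- the volume: `B` and all endpoints of edges of `H` inside `S`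
  obtain ⟨Λ, hBΛ, hΛS, hend⟩ : ∃ Λ : Finset HexVertex, B ⊆ Λ ∧ (↑Λ : Set HexVertex) ⊆ S ∧
      ∀ e ∈ H.edgeSet, (∀ w ∈ e, w ∈ S) → ∀ w ∈ e, w ∈ Λ := by
    refine ⟨B ∪ (hfin.toFinset.filter fun e => ∀ w ∈ e, w ∈ S).biUnion Sym2.toFinset,
      Finset.subset_union_left, fun w hw => ?_, fun e he hS w hw => Finset.mem_union_right _
        (Finset.mem_biUnion.2 ⟨e, Finset.mem_filter.2 ⟨hfin.mem_toFinset.2 he, hS⟩,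
          Sym2.mem_toFinset.2 hw⟩)⟩
    rcases Finset.mem_union.1 (Finset.mem_coe.1 hw) with h | h
    · exact hBS (Finset.mem_coe.2 h)
    · obtain ⟨e, he, hwe⟩ := Finset.mem_biUnion.1 h
      exact (Finset.mem_filter.1 he).2 w (Sym2.mem_toFinset.1 hwe)
  have hedge : ∀ e : Sym2 HexVertex, (e ∈ H.edgeSet ∧ ∀ w ∈ e, w ∈ S) ↔
      (e ∈ H.edgeSet ∧ ∀ w ∈ e, w ∈ (↑Λ : Set HexVertex)) := fun e =>
    ⟨fun h => ⟨h.1, hend e h.1 h.2⟩, fun h => ⟨h.1, fun w hw => hΛS (h.2 w hw)⟩⟩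
  have hN : (∑ᶠ E ∈ {E : Finset (Sym2 HexVertex) | (∀ e ∈ E, e ∈ H.edgeSet ∧ ∀ w ∈ e, w ∈ S) ∧
      ∀ w : HexVertex, (Odd (E.filter (fun e => w ∈ e)).card ↔ (w = u ∨ w = v))},
        Real.tanh β ^ E.card) = hteSum H Λ (Real.tanh β) {u, v} := by
    rw [← itl_finsum_pair_eq_hteSum H Λ (Real.tanh β) u v]
    simp only [hedge]
  have hD : Zloop H S (Real.tanh β) = hteSum H Λ (Real.tanh β) ∅ := by
    unfold Zloop
    rw [← itl_finsum_even_eq_hteSum H Λ (Real.tanh β)]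
    simp only [hedge]
  have hA : ({u, v} : Finset HexVertex) ⊆ B :=
    Finset.insert_subset hu (Finset.singleton_subset_iff.2 hv)
  rw [hN, hD, ← isingCorr_free_eq_hteSum_div H Λ β (hA.trans hBΛ)]
  exact ⟨isingCorr_free_le_of_subset H hβ le_rfl hA hBΛ,
    (isingCorr_le_isingCorr_plus H hβ le_rfl .free (hA.trans hBΛ)).trans
      (isingCorr_plus_le_of_subset H hβ le_rfl hA hBΛ)⟩

/-! ### The GHS boundary bound in the volume `B` -/

/-- The loop two-point ratio `W_B(a, x) / Zloop_B` of `hexGraph` in the volume `B` is nonnegative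
(`t = tanh β ≥ 0`). -/
theorem geo_loopRatio_nonneg {β : ℝ} (hβ : 0 ≤ β) (B : Finset HexVertex) (a x : HexVertex) :
    0 ≤ (∑ᶠ E ∈ {E : Finset (Sym2 HexVertex) |
          (∀ e ∈ E, e ∈ hexGraph.edgeSet ∧ ∀ w ∈ e, w ∈ (↑B : Set HexVertex)) ∧
            ∀ w : HexVertex, (Odd (E.filter (fun e => w ∈ e)).card ↔ (w = a ∨ w = x))},
          Real.tanh β ^ E.card) / Zloop hexGraph (↑B : Set HexVertex) (Real.tanh β) := by
  have ht : 0 ≤ Real.tanh β := by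
    rw [Real.tanh_eq_sinh_div_cosh]
    exact div_nonneg (Real.sinh_nonneg_iff.2 hβ) (Real.cosh_pos β).le
  unfold Zloop
  exact div_nonneg (finsum_nonneg fun E => finsum_nonneg fun _ => pow_nonneg ht _)
    (finsum_nonneg fun E => finsum_nonneg fun _ => pow_nonneg ht _)

/-- **Graph monotonicity + bridge.** For a subgraph `G ≤ hexGraph` and `a ≠ x` in `B`:
`⟨σ_aσ_x⟩^free_{B; G} ≤ ⟨σ_aσ_x⟩^free_{B; hexGraph} = W_B(a, x) / Zloop_B` (GKS II graph monotonicity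
`isingCorr_free_mono_graph`, then the high-temperature expansion of the honeycomb model in `B`). -/
theorem geo_twoPoint_le_loopRatio {G : SimpleGraph HexVertex} [G.LocallyFinite] (hG : G ≤ hexGraph)
    {β : ℝ} (hβ : 0 ≤ β) {B : Finset HexVertex} {a x : HexVertex} (ha : a ∈ B) (hx : x ∈ B)
    (hax : a ≠ x) :
    isingTwoPoint G B β 0 .free a x ≤
      (∑ᶠ E ∈ {E : Finset (Sym2 HexVertex) |
          (∀ e ∈ E, e ∈ hexGraph.edgeSet ∧ ∀ w ∈ e, w ∈ (↑B : Set HexVertex)) ∧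
            ∀ w : HexVertex, (Odd (E.filter (fun e => w ∈ e)).card ↔ (w = a ∨ w = x))},
          Real.tanh β ^ E.card) / Zloop hexGraph (↑B : Set HexVertex) (Real.tanh β) := by
  obtain ⟨_⟩ := geo_nonempty_locallyFinite (le_refl hexGraph)
  have hAB : ({a} : Finset HexVertex) ∆ {x} ⊆ B := by
    rw [itl_symmDiff_singleton_eq_pair hax]
    exact Finset.insert_subset ha (Finset.singleton_subset_iff.2 hx)
  unfold Zloop
  rw [itl_finsum_pair_eq_hteSum hexGraph B (Real.tanh β) a x, itl_finsum_even_eq_hteSum hexGraph B,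
    ← itl_symmDiff_singleton_eq_pair hax, ← isingCorr_free_eq_hteSum_div hexGraph B β hAB,
    isingTwoPoint_eq_isingCorr_symmDiff]
  exact isingCorr_free_mono_graph (fun _ _ _ _ _ _ => GKSInequalities.gks_two_holds G) hG hβ le_rfl hAB

/-- **Boundary bookkeeping.** For `G ≤ hexGraph`, nonnegative `T` on `B` dominated on `B ∩ Bd` by a
nonnegative `R`, and `Bd ⊇` the vertices of `B` with a honeycomb neighbour outside `B`:
`Σ_{x ∈ B} Σ_{y ∼_G x, y ∉ B} T x ≤ 3 Σ_{x ∈ Bd} R x` (a term survives only for `x ∈ Bd`, with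
multiplicity `≤ deg ≤ 3`). -/
theorem geo_boundary_sum_le {G : SimpleGraph HexVertex} [G.LocallyFinite] (hG : G ≤ hexGraph)
    {B Bd : Finset HexVertex} {T R : HexVertex → ℝ} (hT0 : ∀ x ∈ B, 0 ≤ T x)
    (hTR : ∀ x ∈ B, x ∈ Bd → T x ≤ R x) (hR0 : ∀ x ∈ Bd, 0 ≤ R x)
    (hbd : ∀ x ∈ B, ∀ w : HexVertex, hexGraph.Adj x w → w ∉ B → x ∈ Bd) :
    ∑ x ∈ B, ∑ _y ∈ (G.neighborFinset x).filter (· ∉ B), T x ≤ 3 * ∑ x ∈ Bd, R x := by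
  have hterm : ∀ x ∈ B, ∑ _y ∈ (G.neighborFinset x).filter (· ∉ B), T x ≤
      if x ∈ Bd then 3 * R x else 0 := by
    intro x hx
    rw [Finset.sum_const, nsmul_eq_mul]
    split_ifs with hxBd
    · have hcard : (((G.neighborFinset x).filter (· ∉ B)).card : ℝ) ≤ 3 := by
        exact_mod_cast (Finset.card_filter_le _ _).trans (geo_card_neighborFinset_le_three hG x)
      exact mul_le_mul hcard (hTR x hx hxBd) (hT0 x hx) (by norm_num)
    · have hempty : (G.neighborFinset x).filter (· ∉ B) = ∅ := by
        refine Finset.filter_false_of_mem fun y hy hyB => hxBd ?_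
        exact hbd x hx y (hG ((SimpleGraph.mem_neighborFinset G x y).1 hy)) hyB
      rw [hempty, Finset.card_empty, Nat.cast_zero, zero_mul]
  calc ∑ x ∈ B, ∑ _y ∈ (G.neighborFinset x).filter (· ∉ B), T x
      ≤ ∑ x ∈ B, if x ∈ Bd then 3 * R x else 0 := Finset.sum_le_sum hterm
    _ = 3 * ∑ x ∈ B.filter (· ∈ Bd), R x := by
        rw [Finset.sum_filter, Finset.mul_sum]
        refine Finset.sum_congr rfl fun x _ => ?_
        split_ifs <;> simp
    _ ≤ 3 * ∑ x ∈ Bd, R x := by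
        refine mul_le_mul_of_nonneg_left ?_ (by norm_num)
        exact Finset.sum_le_sum_of_subset_of_nonneg (fun x hx => (Finset.mem_filter.1 hx).2)
          fun x hx _ => hR0 x hx

/-- **The GHS boundary bound.** For `G ≤ hexGraph`, `β ≥ 0`, `u ≠ v` in `B ∖ Bd`, and `Bd ⊇` the
vertices of `B` with a honeycomb neighbour outside `B`:
`⟨σ_{{u,v}}⟩^+_{B; G} - ⟨σ_{{u,v}}⟩^free_{B; G} ≤ 9 β² · #B · Σ_{x ∈ Bd} (W_B(u,x) + W_B(v,x)) / Zloop_B`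
(`isingTwoPoint_plus_sub_free_le_boundary`, `isingCorr_plus_singleton_le_boundary_twoPoint`, degree
`3`, graph monotonicity towards `hexGraph`, bridge). -/
theorem geo_plus_sub_free_le {G : SimpleGraph HexVertex} [G.LocallyFinite] (hG : G ≤ hexGraph)
    {β : ℝ} (hβ : 0 ≤ β) {B Bd : Finset HexVertex} {u v : HexVertex} (huv : u ≠ v) (hu : u ∈ B)
    (hv : v ∈ B) (huBd : u ∉ Bd) (hvBd : v ∉ Bd)
    (hbd : ∀ x ∈ B, ∀ w : HexVertex, hexGraph.Adj x w → w ∉ B → x ∈ Bd) :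
    isingCorr G B β 0 .plus {u, v} - isingCorr G B β 0 .free {u, v} ≤
      9 * β ^ 2 * (B.card : ℝ) * ∑ x ∈ Bd, ((∑ᶠ E ∈ {E : Finset (Sym2 HexVertex) |
          (∀ e ∈ E, e ∈ hexGraph.edgeSet ∧ ∀ w ∈ e, w ∈ (↑B : Set HexVertex)) ∧
            ∀ w : HexVertex, (Odd (E.filter (fun e => w ∈ e)).card ↔ (w = u ∨ w = x))},
          Real.tanh β ^ E.card) +
        (∑ᶠ E ∈ {E : Finset (Sym2 HexVertex) |
          (∀ e ∈ E, e ∈ hexGraph.edgeSet ∧ ∀ w ∈ e, w ∈ (↑B : Set HexVertex)) ∧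
            ∀ w : HexVertex, (Odd (E.filter (fun e => w ∈ e)).card ↔ (w = v ∨ w = x))},
          Real.tanh β ^ E.card)) / Zloop hexGraph (↑B : Set HexVertex) (Real.tanh β) := by
  -- abbreviations for the two boundary ratios
  set Ru : HexVertex → ℝ := fun x => (∑ᶠ E ∈ {E : Finset (Sym2 HexVertex) |
      (∀ e ∈ E, e ∈ hexGraph.edgeSet ∧ ∀ w ∈ e, w ∈ (↑B : Set HexVertex)) ∧
        ∀ w : HexVertex, (Odd (E.filter (fun e => w ∈ e)).card ↔ (w = u ∨ w = x))},
      Real.tanh β ^ E.card) / Zloop hexGraph (↑B : Set HexVertex) (Real.tanh β) with hRu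
  set Rv : HexVertex → ℝ := fun x => (∑ᶠ E ∈ {E : Finset (Sym2 HexVertex) |
      (∀ e ∈ E, e ∈ hexGraph.edgeSet ∧ ∀ w ∈ e, w ∈ (↑B : Set HexVertex)) ∧
        ∀ w : HexVertex, (Odd (E.filter (fun e => w ∈ e)).card ↔ (w = v ∨ w = x))},
      Real.tanh β ^ E.card) / Zloop hexGraph (↑B : Set HexVertex) (Real.tanh β) with hRv
  have hsum : ∑ x ∈ Bd, ((∑ᶠ E ∈ {E : Finset (Sym2 HexVertex) |
          (∀ e ∈ E, e ∈ hexGraph.edgeSet ∧ ∀ w ∈ e, w ∈ (↑B : Set HexVertex)) ∧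
            ∀ w : HexVertex, (Odd (E.filter (fun e => w ∈ e)).card ↔ (w = u ∨ w = x))},
          Real.tanh β ^ E.card) +
        (∑ᶠ E ∈ {E : Finset (Sym2 HexVertex) |
          (∀ e ∈ E, e ∈ hexGraph.edgeSet ∧ ∀ w ∈ e, w ∈ (↑B : Set HexVertex)) ∧
            ∀ w : HexVertex, (Odd (E.filter (fun e => w ∈ e)).card ↔ (w = v ∨ w = x))},
          Real.tanh β ^ E.card)) / Zloop hexGraph (↑B : Set HexVertex) (Real.tanh β) =
      ∑ x ∈ Bd, Ru x + ∑ x ∈ Bd, Rv x := by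
    rw [← Finset.sum_add_distrib]
    refine Finset.sum_congr rfl fun x _ => ?_
    rw [hRu, hRv, add_div]
  rw [hsum]
  -- Step 1: GHS boundary-field bound for the two-point function
  have h1 := isingTwoPoint_plus_sub_free_le_boundary G hβ le_rfl hu hv
  rw [isingTwoPoint_eq_isingCorr_symmDiff, isingTwoPoint_eq_isingCorr_symmDiff,
    itl_symmDiff_singleton_eq_pair huv] at h1
  -- Step 2: the number of boundary bonds is at most `3 #B`
  have hcount : ((B.sigma fun x => (G.neighborFinset x).filter (· ∉ B)).card : ℝ) ≤ 3 * B.card := by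
    rw [Finset.card_sigma]
    have h : ∑ x ∈ B, ((G.neighborFinset x).filter (· ∉ B)).card ≤ ∑ x ∈ B, 3 :=
      Finset.sum_le_sum fun x _ =>
        (Finset.card_filter_le _ _).trans (geo_card_neighborFinset_le_three hG x)
    rw [Finset.sum_const, smul_eq_mul, mul_comm] at h
    exact_mod_cast h
  -- Step 3: the boundary magnetisations
  have hmag : ∀ (a : HexVertex), a ∈ B → a ∉ Bd → ∀ (R : HexVertex → ℝ),
      (∀ x, R x = (∑ᶠ E ∈ {E : Finset (Sym2 HexVertex) |
        (∀ e ∈ E, e ∈ hexGraph.edgeSet ∧ ∀ w ∈ e, w ∈ (↑B : Set HexVertex)) ∧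
          ∀ w : HexVertex, (Odd (E.filter (fun e => w ∈ e)).card ↔ (w = a ∨ w = x))},
        Real.tanh β ^ E.card) / Zloop hexGraph (↑B : Set HexVertex) (Real.tanh β)) →
      isingCorr G B β 0 .plus {a} ≤ β * (3 * ∑ x ∈ Bd, R x) := by
    intro a ha haBd R hR
    refine (isingCorr_plus_singleton_le_boundary_twoPoint G hβ ha).trans
      (mul_le_mul_of_nonneg_left ?_ hβ)
    refine geo_boundary_sum_le hG (T := fun x => isingTwoPoint G B β 0 .free a x) (R := R)
      (fun x hx => ?_) (fun x hx hxBd => ?_) (fun x _ => ?_) hbd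
    · -- GKS I
      rw [isingTwoPoint_eq_isingCorr_symmDiff]
      refine GKSInequalities.gks_one_holds G hβ le_rfl (Or.inl rfl) (symmDiff_le_sup.trans ?_)
      exact sup_le (Finset.singleton_subset_iff.2 ha) (Finset.singleton_subset_iff.2 hx)
    · have hax : a ≠ x := fun h => haBd (h ▸ hxBd)
      rw [hR x]
      exact geo_twoPoint_le_loopRatio hG hβ ha hx hax
    · rw [hR x]
      exact geo_loopRatio_nonneg hβ B a x
  have hmu := hmag u hu huBd Ru fun x => by rw [hRu]
  have hmv := hmag v hv hvBd Rv fun x => by rw [hRv]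
  have hm0 : ∀ a ∈ B, 0 ≤ isingCorr G B β 0 .plus {a} := fun a ha =>
    GKSInequalities.gks_one_holds G hβ le_rfl (Or.inr rfl) (Finset.singleton_subset_iff.2 ha)
  have hR0 : 0 ≤ ∑ x ∈ Bd, Ru x + ∑ x ∈ Bd, Rv x := add_nonneg
    (Finset.sum_nonneg fun x _ => geo_loopRatio_nonneg hβ B u x)
    (Finset.sum_nonneg fun x _ => geo_loopRatio_nonneg hβ B v x)
  calc isingCorr G B β 0 .plus {u, v} - isingCorr G B β 0 .free {u, v}
      ≤ β * ((B.sigma fun x => (G.neighborFinset x).filter (· ∉ B)).card : ℝ) *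
          (isingCorr G B β 0 .plus {u} + isingCorr G B β 0 .plus {v}) := h1
    _ ≤ β * (3 * B.card) * (β * (3 * ∑ x ∈ Bd, Ru x) + β * (3 * ∑ x ∈ Bd, Rv x)) :=
        mul_le_mul (mul_le_mul_of_nonneg_left hcount hβ) (add_le_add hmu hmv)
          (add_nonneg (hm0 u hu) (hm0 v hv)) (by positivity)
    _ = 9 * β ^ 2 * (B.card : ℝ) * (∑ x ∈ Bd, Ru x + ∑ x ∈ Bd, Rv x) := by ring

/-! ### The stub -/

/-- **Stub `stub_isingTwoPointLocality` (MIsing).** Locality of the high-temperature (loop-gas)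
two-point function `W / Zloop = ⟨σ_uσ_v⟩^free` of finite subgraphs `H₁, H₂ ≤ hexGraph` read inside
`S₁, S₂` that agree inside a finite set `B ∋ u, v` (`B ⊆ S₁ ∩ S₂`): the two values differ by at most
`9 β² · #B · Σ_{x ∈ Bd} (W_B(u,x) + W_B(v,x)) / Zloop_B`. Proof: GKS sandwich
`⟨⟩^free_{B; H_j} ≤ W_j/Z_j ≤ ⟨⟩^+_{B; H_j}` (`itl_sandwich`), the common lower end
(`isingMeasure_free_congr_edgesIn`), and the GHS boundary bound `geo_plus_sub_free_le`. -/
theorem stub_isingTwoPointLocality :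
    ∀ (β : ℝ), 0 ≤ β → ∀ (H₁ H₂ : SimpleGraph Literature.Probability.LatticeModels.HexVertex), H₁ ≤ Literature.Probability.LatticeModels.hexGraph → H₂ ≤ Literature.Probability.LatticeModels.hexGraph → H₁.edgeSet.Finite → H₂.edgeSet.Finite → ∀ (S₁ S₂ : Set Literature.Probability.LatticeModels.HexVertex) (B Bd : Finset Literature.Probability.LatticeModels.HexVertex) (u v : Literature.Probability.LatticeModels.HexVertex), u ≠ v → u ∈ B → v ∈ B → u ∉ Bd → v ∉ Bd → (↑B : Set Literature.Probability.LatticeModels.HexVertex) ⊆ S₁ → (↑B : Set Literature.Probability.LatticeModels.HexVertex) ⊆ S₂ → (∀ x ∈ B, ∀ w : Literature.Probability.LatticeModels.HexVertex, Literature.Probability.LatticeModels.hexGraph.Adj x w → w ∉ B → x ∈ Bd) → (∀ x ∈ B, ∀ w ∈ B, (H₁.Adj x w ↔ H₂.Adj x w)) → |(∑ᶠ E ∈ {E : Finset (Sym2 Literature.Probability.LatticeModels.HexVertex) | (∀ e ∈ E, e ∈ (H₁).edgeSet ∧ ∀ w ∈ e, w ∈ S₁) ∧ ∀ w : Literature.Probability.LatticeModels.HexVertex,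 (Odd (E.filter (fun e => w ∈ e)).card ↔ (w = u ∨ w = v))}, (Real.tanh β) ^ E.card) / Summit.CriticalPhenomena.SAWScalingLimit.Theorems.SAWMassiveIsingTilt.Zloop H₁ S₁ (Real.tanh β) - (∑ᶠ E ∈ {E : Finset (Sym2 Literature.Probability.LatticeModels.HexVertex) | (∀ e ∈ E, e ∈ (H₂).edgeSet ∧ ∀ w ∈ e, w ∈ S₂) ∧ ∀ w : Literature.Probability.LatticeModels.HexVertex, (Odd (E.filter (fun e => w ∈ e)).card ↔ (w = u ∨ w = v))}, (Real.tanh β) ^ E.card) / Summit.CriticalPhenomena.SAWScalingLimit.Theorems.SAWMassiveIsingTilt.Zloop H₂ S₂ (Real.tanh β)| ≤ 9 * β ^ 2 * (B.card : ℝ) * ∑ x ∈ Bd, ((∑ᶠ E ∈ {E : Finset (Sym2 Literature.Probability.LatticeModels.HexVertex) | (∀ e ∈ E, e ∈ (Literature.Probability.LatticeModels.hexGraph).edgeSet ∧ ∀ w ∈ e, w ∈ (↑B : Set Literature.Probability.LatticeModels.HexVertex)) ∧ ∀ w : Literature.Probability.LatticeModels.HexVertex, (Odd (E.filter (fun e =>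 w ∈ e)).card ↔ (w = u ∨ w = x))}, (Real.tanh β) ^ E.card) + (∑ᶠ E ∈ {E : Finset (Sym2 Literature.Probability.LatticeModels.HexVertex) | (∀ e ∈ E, e ∈ (Literature.Probability.LatticeModels.hexGraph).edgeSet ∧ ∀ w ∈ e, w ∈ (↑B : Set Literature.Probability.LatticeModels.HexVertex)) ∧ ∀ w : Literature.Probability.LatticeModels.HexVertex, (Odd (E.filter (fun e => w ∈ e)).card ↔ (w = v ∨ w = x))}, (Real.tanh β) ^ E.card)) / Summit.CriticalPhenomena.SAWScalingLimit.Theorems.SAWMassiveIsingTilt.Zloop Literature.Probability.LatticeModels.hexGraph (↑B : Set Literature.Probability.LatticeModels.HexVertex) (Real.tanh β) := by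
  intro β hβ H₁ H₂ hH₁ hH₂ hfin₁ hfin₂ S₁ S₂ B Bd u v huv hu hv huBd hvBd hBS₁ hBS₂ hbd hagree
  obtain ⟨_⟩ := geo_nonempty_locallyFinite hH₁
  obtain ⟨_⟩ := geo_nonempty_locallyFinite hH₂
  obtain ⟨hl₁, hu₁⟩ := itl_sandwich hfin₁ hBS₁ hu hv hβ
  obtain ⟨hl₂, hu₂⟩ := itl_sandwich hfin₂ hBS₂ hu hv hβ
  -- the free states in the volume `B` coincide: same edges inside `B`
  have hE : edgesIn H₁ B = edgesIn H₂ B := by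
    ext e
    rw [mem_edgesIn_iff, mem_edgesIn_iff]
    induction e using Sym2.ind with
    | _ x y =>
      simp only [SimpleGraph.mem_edgeSet, Sym2.mem_iff, forall_eq_or_imp, forall_eq]
      exact ⟨fun ⟨hadj, hx, hy⟩ => ⟨(hagree x hx y hy).1 hadj, hx, hy⟩,
        fun ⟨hadj, hx, hy⟩ => ⟨(hagree x hx y hy).2 hadj, hx, hy⟩⟩
  have hfree : isingCorr H₁ B β 0 .free {u, v} = isingCorr H₂ B β 0 .free {u, v} := by
    simp only [isingCorr, isingExpect, isingMeasure_free_congr_edgesIn hE]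
  have hb₁ := geo_plus_sub_free_le (Bd := Bd) hH₁ hβ huv hu hv huBd hvBd hbd
  have hb₂ := geo_plus_sub_free_le (Bd := Bd) hH₂ hβ huv hu hv huBd hvBd hbd
  rw [abs_sub_le_iff]
  constructor <;> linarith

end Summit.CriticalPhenomena.SAWScalingLimit.Theorems.MassiveWindowSLE.Birth

end
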